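import Summits.AnomalousDissipation.AnomalousDissipation.Theorems.MomentParityGalerkinEnsembleRealization

/-!
# Stub S4 `stub_realisedStrictInequality` for line `lh-energy-equality-bracket` of crux
# `MomentParity.ResolvedDissipation` (stmt-AnomalousDissipation-14284)

**Vishik–Fursikov realisation keeps a strict window energy inequality.** Let `ω` be a path of the
trajectory space `𝒦 = pathSpace R (pathLip ν A R)` (`MomentParityDefs`) which is the coefficientwise
limit, at every time `t ≥ 0`, of the orbit paths of confined Galerkin orbits of levels `N j → ∞`
(the output of the landed `stub_supportApprox`), and suppose that on the window `[1, 2]` the path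
has a STRICT energy inequality in `ℝ≥0∞`,
`½E(ω,2) + sup_K ∫₁² D_K(ω,t) dt < ½E(ω,1) + ∫₁² Σ_k Re⟪𝓕f k, ω̄(t,k)⟫ dt`
(`E = pathEnergyTot`, `D_K = pathDiss ν K`). Then the Navier–Stokes equations with the steady
force `f` have a GLOBAL LERAY–HOPF SOLUTION `u` (tree's sense `Torus.IsGlobalLerayHopf`, datum
`u 0`) and times `0 < t₀ ≤ t₁` with the strict energy inequality
`½‖u(t₁)‖² + ν∫_{t₀}^{t₁}‖∇u‖² < ½‖u(t₀)‖² + ∫_{t₀}^{t₁} (f, u(t)) dt`.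

Proof. (1) `exists_realisation_Ioo`: the landed realisation `stub_realisation`
(`MomentParityGalerkinEnsembleRealizationStubRealisation`) re-run with its a.e. strong time
`s ∈ (0, 1)` recorded (the restart argument picks `s` in `Ioo 0 1` through
`IsHopfGalerkinFamily.exists_strictMono_ae_tendsto_eLpNorm`): `𝓕(u t)(k) = ω̄(s + t, k)` for
`t ≥ 0`. (2) Parseval three times along the realised field, with `t₀ = 1 - s`, `t₁ = 2 - s`:
`½∫‖u t‖² = ½ E(ω, s + t)` (`integral_norm_sq_pathField`); `‖∇u(τ)‖₂² = sup_K 4π² Σ_{|k|≤K}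
|k|²‖ω̄(s+τ,k)‖²` (`eGradNormSq_eq_tsum`, exhaustion by the frequency balls) and monotone
convergence `∫⁻ sup_K = sup_K ∫⁻`; `∫⟪f, u τ⟫ = Σ_k Re⟪𝓕f k, ω̄(s+τ,k)⟫`
(`hasSum_re_inner_mFourierCoeff_complexify`); the time variable is translated by `s`, and the
`ℝ≥0∞` strict inequality forces the dissipation to be finite, so `toReal` is exact.

References: Foias–Rosa–Temam 2013 (arXiv:1111.6257), proof of Thm. 3.1; Vishik–Fursikov 1988,
Ch. IV; Foias–Manley–Rosa–Temam 2001, Ch. IV App. B (all folklore bookkeeping here).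
-/

noncomputable section

-- every `Summit.AnomalousDissipation.AnomalousDissipation.…` name repeats the summit = sub-problem segment (D-0017 layout)
set_option linter.dupNamespace false

namespace Summit.AnomalousDissipation.AnomalousDissipation.Theorems.MomentParityResolvedDissipation.LhBracket.RealisedStrictInequality

open MeasureTheory Filter Topology Set Function Metric UnitAddTorus
open scoped ENNReal InnerProductSpace RealInnerProductSpace BigOperators
open Literature.Analysis.FunctionSpaces Literature.Analysis.FunctionSpaces.Torus
open Literature.Analysis.FluidPDE Literature.Analysis.FluidPDE.Torus
open Summit.AnomalousDissipation.AnomalousDissipation.Theorems.MomentParity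

variable {ν : ℝ} {f : UnitAddTorus (Fin 3) → EuclideanSpace ℝ (Fin 3)}

/-! ### (1) Realisation with the strong time recorded in `(0, 1)` -/

/-- **Realisation after a strong time `s ∈ (0, 1)`.** A path `ω ∈ 𝒦` which is the pointwise limit
of orbit paths of confined Galerkin orbits of levels `N j → ∞` is realised, after a time shift
`s ∈ (0, 1)`, by a global Leray–Hopf solution: `𝓕(u t)(k) = ω̄(s + t, k)` for all `t ≥ 0`.
(The landed `stub_realisation` with its strong time exposed: the restart time is chosen among the
a.e. strong times of `(0, 1)`.) [folklore; FoiasRosaTemam2013 Thm 3.1 (proof)] -/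
theorem exists_realisation_Ioo (hν : 0 < ν) (hf : IsSmooth f) {R A : ℝ} {N : ℕ → ℕ}
    (hN : Tendsto N atTop atTop)
    {c : (j : ℕ) → ↥(freqBall (N j) : Finset (Fin 3 → ℤ)) → EuclideanSpace ℂ (Fin 3)}
    (hc : ∀ j, c j ∈ galerkinSubspace (freqBall (N j)))
    (hconf : ∀ j t, 0 ≤ t → ∑ k ∈ freqBall (N j), ‖coeffExt (freqBall (N j))
      (galerkinCoeffFlow ν (fourierRestrict (freqBall (N j)) f) t (c j)) k‖ ^ 2 ≤ R ^ 2)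
    (hmem : ∀ j, orbitPath ν (fourierRestrict (freqBall (N j)) f) (c j) ∈ pathSpace R (pathLip ν A R))
    {ω : Path (Fin 3)} (hω : ω ∈ pathSpace R (pathLip ν A R))
    (hlim : ∀ t, 0 ≤ t → ∀ k, Tendsto
      (fun j => pathExt (orbitPath ν (fourierRestrict (freqBall (N j)) f) (c j)) t k) atTop
      (𝓝 (pathExt ω t k))) :
    ∃ s : ℝ, 0 < s ∧ s < 1 ∧ ∃ u : ℝ → UnitAddTorus (Fin 3) → EuclideanSpace ℝ (Fin 3),
      IsGlobalLerayHopf ν (fun _ => f) (u 0) u ∧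
      ∀ t, 0 ≤ t → MemLp (u t) 2 volume ∧
        ∀ k, mFourierCoeff (EuclideanSpace.complexify ∘ u t) k = pathExt ω (s + t) k := by
  -- adapted from `stub_realisation` (MomentParityGalerkinEnsembleRealizationStubRealisation), same proof,
  -- keeping `s ∈ Ioo 0 1`
  have hS : ∀ j, ∀ k ∈ (freqBall (N j) : Finset (Fin 3 → ℤ)), -k ∈ (freqBall (N j) : Finset (Fin 3 → ℤ)) :=
    fun j => neg_mem_freqBall_of_mem
  have hg : ∀ j, IsRealCoeff (fourierRestrict (freqBall (N j)) f) := fun j =>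
    isRealCoeff_mFourierCoeff hf.integrable
  have hR : ∀ j, ∑ k ∈ freqBall (N j), ‖coeffExt (freqBall (N j)) (c j) k‖ ^ 2 ≤ R ^ 2 := fun j => by
    simpa only [galerkinCoeffFlow_zero] using hconf j 0 le_rfl
  -- the Galerkin orbits as a Hopf–Galerkin family
  obtain ⟨U, hU⟩ : ∃ U : ℕ → ℝ → UnitAddTorus (Fin 3) → EuclideanSpace ℝ (Fin 3),
      U = fun j t => galerkinFlow ν f (N j) t
        (realTrigPoly (freqBall (N j)) (coeffExt (freqBall (N j)) (c j))) := ⟨_, rfl⟩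
  have hUjt : ∀ j t, U j t = galerkinFlow ν f (N j) t
      (realTrigPoly (freqBall (N j)) (coeffExt (freqBall (N j)) (c j))) := fun j t => by rw [hU]
  have hF : IsHopfGalerkinFamily ν (fun _ => f) (fun _ => EuclideanSpace.single (0 : Fin 3) R) N
      (fun _ _ => f) U := by
    rw [hU]; exact isHopfGalerkinFamily_galerkinFlow hν.le hf hN hc hR
  -- common data for the family theorems
  have hu₀ : MemLp (fun _ : UnitAddTorus (Fin 3) => EuclideanSpace.single (0 : Fin 3) R) 2 volume :=
    memLp_const _
  have hfm := aestronglyMeasurable_stLift_const hf (volume.restrict (Ioi (0 : ℝ) ×ˢ univ))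
  have hf₂ : ∀ T : ℝ, 0 < T → ∫⁻ _ in Ioo (0 : ℝ) T, ∫⁻ x, ‖f x‖ₑ ^ 2 < ⊤ := fun T _ =>
    lintegral_force_lt_top hf T
  -- the field of `ω` (no shift) and coefficientwise convergence
  obtain ⟨u, hum, hu⟩ := exists_pathField hω 0
  simp only [zero_add] at hu
  have hu2 : ∀ t, 0 ≤ t → MemLp (u t) 2 volume := fun t ht => (hu t ht).1
  have hcoefU : ∀ j t, 0 ≤ t → ∀ k, mFourierCoeff (EuclideanSpace.complexify ∘ U j t) k =
      pathExt (orbitPath ν (fourierRestrict (freqBall (N j)) f) (c j)) t k := fun j t ht k => by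
    rw [hUjt, mFourierCoeff_galerkinFlow_realTrigPoly (hc j),
      pathExt_orbitPath hν.le (hS j) (hg j) (hc j) (hmem j) ht k]
  have hcv : ∀ t, 0 ≤ t → ∀ k, Tendsto (fun j => mFourierCoeff (EuclideanSpace.complexify ∘ U j t) k)
      atTop (𝓝 (mFourierCoeff (EuclideanSpace.complexify ∘ u t) k)) := by
    intro t ht k
    rw [(hu t ht).2 k]
    exact (hlim t ht k).congr fun j => (hcoefU j t ht k).symm
  -- strong convergence at a.e. time along a subsequence
  obtain ⟨φ, hφ, hae⟩ := hF.exists_strictMono_ae_tendsto_eLpNorm hν hu₀ hfm hf₂ hum hu2 hcv one_pos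
  -- pick a strong time `s ∈ (0, 1)`
  have hne : NeBot (ae (volume.restrict (Ioo (0 : ℝ) 1))) := by
    rw [ae_neBot, Ne, Measure.restrict_eq_zero]
    simp
  obtain ⟨s, hs_strong, hs_mem⟩ := (hae.and (ae_restrict_mem measurableSet_Ioo)).exists
  have hs : 0 ≤ s := hs_mem.1.le
  -- the restarted data and orbits
  set c' : (j : ℕ) → ↥(freqBall (N (φ j)) : Finset (Fin 3 → ℤ)) → EuclideanSpace ℂ (Fin 3) := fun j =>
    galerkinCoeffFlow ν (fourierRestrict (freqBall (N (φ j))) f) s (c (φ j)) with hc'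
  have hc'mem : ∀ j, c' j ∈ galerkinSubspace (freqBall (N (φ j))) := fun j =>
    galerkinCoeffFlow_mem (hc (φ j)) s
  have hR' : ∀ j, ∑ k ∈ freqBall (N (φ j)), ‖coeffExt (freqBall (N (φ j))) (c' j) k‖ ^ 2 ≤ R ^ 2 :=
    fun j => hconf (φ j) s hs
  have hflow : ∀ j t, 0 ≤ t → galerkinCoeffFlow ν (fourierRestrict (freqBall (N (φ j))) f) t (c' j) =
      galerkinCoeffFlow ν (fourierRestrict (freqBall (N (φ j))) f) (t + s) (c (φ j)) := fun j t ht => by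
    rw [hc', ← galerkinCoeffFlow_add hν.le (hS (φ j)) (hg (φ j)) (hc (φ j)) ht hs]
  obtain ⟨U', hU'⟩ : ∃ U' : ℕ → ℝ → UnitAddTorus (Fin 3) → EuclideanSpace ℝ (Fin 3),
      U' = fun j t => galerkinFlow ν f (N (φ j)) t
        (realTrigPoly (freqBall (N (φ j))) (coeffExt (freqBall (N (φ j))) (c' j))) := ⟨_, rfl⟩
  have hU'jt : ∀ j t, U' j t = galerkinFlow ν f (N (φ j)) t
      (realTrigPoly (freqBall (N (φ j))) (coeffExt (freqBall (N (φ j))) (c' j))) := fun j t => by rw [hU']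
  have hF' : IsHopfGalerkinFamily ν (fun _ => f) (fun _ => EuclideanSpace.single (0 : Fin 3) R) (N ∘ φ)
      (fun _ _ => f) U' := by
    rw [hU']; exact isHopfGalerkinFamily_galerkinFlow hν.le hf (hN.comp hφ.tendsto_atTop) hc'mem hR'
  -- the field of `ω` shifted by `s`
  obtain ⟨u', hum', hu'⟩ := exists_pathField hω s
  have hu'2 : ∀ t, 0 ≤ t → MemLp (u' t) 2 volume := fun t ht => (hu' t ht).1
  -- coefficients of the restarted orbits and their convergence
  have hcoefU' : ∀ j t, 0 ≤ t → ∀ k, mFourierCoeff (EuclideanSpace.complexify ∘ U' j t) k =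
      pathExt (orbitPath ν (fourierRestrict (freqBall (N (φ j))) f) (c (φ j))) (s + t) k := by
    intro j t ht k
    rw [hU'jt, mFourierCoeff_galerkinFlow_realTrigPoly (hc'mem j), hflow j t ht,
      pathExt_orbitPath hν.le (hS (φ j)) (hg (φ j)) (hc (φ j)) (hmem (φ j)) (by positivity) k,
      add_comm t s]
  have hcv' : ∀ t, 0 ≤ t → ∀ k, Tendsto (fun j => mFourierCoeff (EuclideanSpace.complexify ∘ U' j t) k)
      atTop (𝓝 (mFourierCoeff (EuclideanSpace.complexify ∘ u' t) k)) := by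
    intro t ht k
    rw [(hu' t ht).2 k]
    have h := (hlim (s + t) (by positivity) k).comp hφ.tendsto_atTop
    exact h.congr fun j => (hcoefU' j t ht k).symm
  -- strong convergence at the new initial time
  have h0' : Tendsto (fun j => eLpNorm (U' j 0 - u' 0) 2 volume) atTop (𝓝 0) := by
    have hUs : ∀ j, U' j 0 = U (φ j) s := fun j => by
      rw [hU'jt, galerkinFlow_zero, hUjt, galerkinFlow_realTrigPoly (hc (φ j))]
    have hus : eLpNorm (u s - u' 0) 2 volume = 0 := by
      refine eLpNorm_sub_eq_zero_of_mFourierCoeff_eq (hu2 s hs) (hu'2 0 le_rfl) fun k => ?_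
      rw [(hu s hs).2 k, (hu' 0 le_rfl).2 k, add_zero]
    have hle : ∀ j, eLpNorm (U' j 0 - u' 0) 2 volume ≤ eLpNorm (U (φ j) s - u s) 2 volume := by
      intro j
      rw [hUs j]
      have hsplit : U (φ j) s - u' 0 = (U (φ j) s - u s) + (u s - u' 0) := by abel
      rw [hsplit]
      refine (eLpNorm_add_le ?_ ?_ one_le_two).trans ?_
      · exact ((hF.memLp_slice (φ j) hs).sub (hu2 s hs)).aestronglyMeasurable
      · exact ((hu2 s hs).sub (hu'2 0 le_rfl)).aestronglyMeasurable
      · rw [hus, add_zero]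
    exact tendsto_of_tendsto_of_tendsto_of_le_of_le tendsto_const_nhds hs_strong
      (fun j => bot_le) hle
  -- the family theorem from the new datum
  have hLH := hF'.isGlobalLerayHopf_limit hν hu₀ hfm hf₂ hum' hu'2 hcv' h0'
  exact ⟨s, hs_mem.1, hs_mem.2, u', hLH, hu'⟩

/-! ### (2) Parseval bookkeeping along a realised path -/

/-- `pathDiss ν K ω t = ν * pathDiss 1 K ω t` (the viscosity factors out). -/
theorem pathDiss_eq_mul_pathDiss_one (ν : ℝ) (K : ℕ) (ω : Path (Fin 3)) (t : ℝ) :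
    pathDiss ν K ω t = ν * pathDiss 1 K ω t := by
  unfold pathDiss
  rw [one_mul]

/-- The resolved dissipation is monotone in the cutoff (`ν ≥ 0`). -/
theorem pathDiss_mono_cutoff {ν : ℝ} (hν : 0 ≤ ν) {K K' : ℕ} (hKK' : K ≤ K') (ω : Path (Fin 3))
    (t : ℝ) : pathDiss ν K ω t ≤ pathDiss ν K' ω t := by
  unfold pathDiss
  exact mul_le_mul_of_nonneg_left (mul_le_mul_of_nonneg_left
    (Finset.sum_le_sum_of_subset_of_nonneg (freqBall_mono hKK')
      fun k _ _ => mul_nonneg (freqNormSq_nonneg k) (sq_nonneg _)) (by positivity)) hν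

/-- The resolved dissipation of a path of `𝒦` is continuous in time. -/
theorem continuous_pathDiss_time {R : ℝ} {L : (Fin 3 → ℤ) → ℝ} {ω : Path (Fin 3)}
    (hω : ω ∈ pathSpace R L) (ν : ℝ) (K : ℕ) : Continuous fun t => pathDiss ν K ω t := by
  -- (elaborate the composition before matching it against the goal: a direct term times out)
  have h := (continuous_pathDiss R L ν K).comp (Continuous.prodMk_right (⟨ω, hω⟩ : ↥(pathSpace R L)))
  exact h

/-- **The spectral enstrophy is the supremum of the resolved enstrophies**:
`‖∇v‖₂² = sup_K ofReal (4π² Σ_{|k| ≤ K} |k|² ‖𝓕v(k)‖²)` in `ℝ≥0∞` (exhaustion of the Parseval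
series `eGradNormSq_eq_tsum` by the frequency balls). [folklore] -/
theorem eGradNormSq_eq_iSup_ofReal (v : UnitAddTorus (Fin 3) → EuclideanSpace ℝ (Fin 3)) :
    eGradNormSq v = ⨆ K : ℕ, ENNReal.ofReal (4 * Real.pi ^ 2 * ∑ k ∈ freqBall K, freqNormSq k *
      ‖mFourierCoeff (EuclideanSpace.complexify ∘ v) k‖ ^ 2) := by
  refine le_antisymm ?_ (iSup_le fun K => ofReal_sum_freqNormSq_mul_norm_sq_le (freqBall K) v)
  -- the partial sums over the balls tend to the series, and each is below the supremum
  set a : (Fin 3 → ℤ) → ℝ≥0∞ := fun k => ENNReal.ofReal (freqNormSq k) *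
    ‖mFourierCoeff (EuclideanSpace.complexify ∘ v) k‖ₑ ^ 2 with ha
  have hsum : HasSum a (∑' k, a k) := ENNReal.summable.hasSum
  have htend : Tendsto (fun K : ℕ => ∑ k ∈ freqBall K, a k) atTop (𝓝 (∑' k, a k)) :=
    hsum.comp tendsto_freqBall_atTop
  have hpart : ∀ K : ℕ, ENNReal.ofReal (4 * Real.pi ^ 2) * ∑ k ∈ freqBall K, a k =
      ENNReal.ofReal (4 * Real.pi ^ 2 * ∑ k ∈ freqBall K, freqNormSq k *
        ‖mFourierCoeff (EuclideanSpace.complexify ∘ v) k‖ ^ 2) := by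
    intro K
    have h4 : (0 : ℝ) ≤ 4 * Real.pi ^ 2 := by positivity
    rw [show ENNReal.ofReal (4 * Real.pi ^ 2 * ∑ k ∈ freqBall K, freqNormSq k *
        ‖mFourierCoeff (EuclideanSpace.complexify ∘ v) k‖ ^ 2) = ENNReal.ofReal (4 * Real.pi ^ 2) *
        ENNReal.ofReal (∑ k ∈ freqBall K, freqNormSq k *
          ‖mFourierCoeff (EuclideanSpace.complexify ∘ v) k‖ ^ 2) from ENNReal.ofReal_mul h4,
      ENNReal.ofReal_sum_of_nonneg fun k _ => mul_nonneg (freqNormSq_nonneg k) (sq_nonneg _)]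
    congr 1
    refine Finset.sum_congr rfl fun k _ => ?_
    rw [ha, ENNReal.ofReal_mul (freqNormSq_nonneg k)]
    beta_reduce
    rw [enorm_sq_eq_ofReal_norm_sq]
  have hle : ∑' k, a k ≤ ⨆ K : ℕ, ∑ k ∈ freqBall K, a k :=
    le_of_tendsto' htend fun K => le_iSup (fun K : ℕ => ∑ k ∈ freqBall K, a k) K
  rw [eGradNormSq_eq_tsum]
  calc ENNReal.ofReal (4 * Real.pi ^ 2) * ∑' k, a k
      ≤ ENNReal.ofReal (4 * Real.pi ^ 2) * ⨆ K : ℕ, ∑ k ∈ freqBall K, a k := by gcongr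
    _ = ⨆ K : ℕ, ENNReal.ofReal (4 * Real.pi ^ 2) * ∑ k ∈ freqBall K, a k := ENNReal.mul_iSup _ _
    _ = _ := iSup_congr hpart

/-- **The enstrophy of a realised path over a window**: if `𝓕(u t) = ω̄(s + t, ·)` for `t ≥ 0`
(`ω ∈ 𝒦`), then for `0 ≤ a ≤ b`
`∫⁻_{(a,b)} ‖∇u(τ)‖₂² dτ = sup_K ofReal (∫_{s+a}^{s+b} 4π² Σ_{|k|≤K} |k|² ‖ω̄(t,k)‖² dt)`
(the integrand on the right is `pathDiss 1 K ω t`; monotone convergence in the cutoff, then translation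
of the time variable). [folklore] -/
theorem lintegral_eGradNormSq_pathField {R : ℝ} {L : (Fin 3 → ℤ) → ℝ} {ω : Path (Fin 3)}
    (hω : ω ∈ pathSpace R L) {s : ℝ} {u : ℝ → UnitAddTorus (Fin 3) → EuclideanSpace ℝ (Fin 3)}
    (hcoef : ∀ t, 0 ≤ t → ∀ k, mFourierCoeff (EuclideanSpace.complexify ∘ u t) k = pathExt ω (s + t) k)
    {a b : ℝ} (ha : 0 ≤ a) (hab : a ≤ b) :
    ∫⁻ τ in Ioo a b, eGradNormSq (u τ) =
      ⨆ K : ℕ, ENNReal.ofReal (∫ t in (s + a)..(s + b), pathDiss 1 K ω t) := by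
  -- pointwise on `(a, b)`: the enstrophy is the supremum of the resolved enstrophies of the path
  have hpt : ∀ τ ∈ Ioo a b, eGradNormSq (u τ) =
      ⨆ K : ℕ, ENNReal.ofReal (pathDiss 1 K ω (s + τ)) := by
    intro τ hτ
    rw [eGradNormSq_eq_iSup_ofReal]
    refine iSup_congr fun K => ?_
    unfold pathDiss
    rw [one_mul]
    simp_rw [hcoef τ (ha.trans hτ.1.le)]
  rw [setLIntegral_congr_fun measurableSet_Ioo hpt]
  -- monotone convergence in the cutoff
  have hmeas : ∀ K : ℕ, Measurable fun τ => ENNReal.ofReal (pathDiss 1 K ω (s + τ)) := fun K =>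
    ENNReal.measurable_ofReal.comp
      ((continuous_pathDiss_time hω 1 K).comp (continuous_const.add continuous_id)).measurable
  have hmono : Monotone fun K : ℕ => fun τ => ENNReal.ofReal (pathDiss 1 K ω (s + τ)) :=
    fun K K' hKK' τ => ENNReal.ofReal_le_ofReal (pathDiss_mono_cutoff zero_le_one hKK' ω (s + τ))
  rw [lintegral_iSup hmeas hmono]
  refine iSup_congr fun K => ?_
  -- a nonnegative continuous integrand: `∫⁻ ofReal = ofReal ∫`, then translate the time
  have hcont : Continuous fun τ => pathDiss 1 K ω (s + τ) :=
    (continuous_pathDiss_time hω 1 K).comp (continuous_const.add continuous_id)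
  have hint : IntegrableOn (fun τ => pathDiss 1 K ω (s + τ)) (Ioo a b) volume :=
    (hcont.integrableOn_Icc (a := a) (b := b)).mono_set Ioo_subset_Icc_self
  rw [← ofReal_integral_eq_lintegral_ofReal hint
      (ae_of_all _ fun τ => pathDiss_nonneg zero_le_one K ω (s + τ)),
    ← integral_Ioc_eq_integral_Ioo, ← intervalIntegral.integral_of_le hab,
    intervalIntegral.integral_comp_add_left (fun t => pathDiss 1 K ω t) s]

/-- **The work along a realised path over a window**: if `u t ∈ L²` and `𝓕(u t) = ω̄(s + t, ·)`
for `t ≥ 0`, then for `0 ≤ a ≤ b` and `f ∈ L²`,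
`∫ₐᵇ ∫⟪f, u τ⟫ dτ = ∫_{s+a}^{s+b} Σ_k Re⟪𝓕f k, ω̄(t,k)⟫ dt` (Parseval, then translation). [folklore] -/
private theorem intervalIntegral_work_pathField {ω : Path (Fin 3)} {s : ℝ}
    {u : ℝ → UnitAddTorus (Fin 3) → EuclideanSpace ℝ (Fin 3)} (hf : MemLp f 2 volume)
    (hu : ∀ t, 0 ≤ t → MemLp (u t) 2 volume ∧
      ∀ k, mFourierCoeff (EuclideanSpace.complexify ∘ u t) k = pathExt ω (s + t) k)
    {a b : ℝ} (ha : 0 ≤ a) (hab : a ≤ b) :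
    ∫ τ in a..b, ∫ x, ⟪f x, u τ x⟫_ℝ =
      ∫ t in (s + a)..(s + b), ∑' k : Fin 3 → ℤ,
        (inner ℂ (mFourierCoeff (EuclideanSpace.complexify ∘ f) k) (pathExt ω t k)).re := by
  have heq : ∀ τ ∈ uIcc a b, ∫ x, ⟪f x, u τ x⟫_ℝ = ∑' k : Fin 3 → ℤ,
      (inner ℂ (mFourierCoeff (EuclideanSpace.complexify ∘ f) k) (pathExt ω (s + τ) k)).re := by
    intro τ hτ
    rw [uIcc_of_le hab] at hτ
    have hτ0 : 0 ≤ τ := ha.trans hτ.1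
    rw [← (hasSum_re_inner_mFourierCoeff_complexify hf (hu τ hτ0).1).tsum_eq]
    exact tsum_congr fun k => by rw [(hu τ hτ0).2 k]
  rw [intervalIntegral.integral_congr heq,
    intervalIntegral.integral_comp_add_left (fun t => ∑' k : Fin 3 → ℤ,
      (inner ℂ (mFourierCoeff (EuclideanSpace.complexify ∘ f) k) (pathExt ω t k)).re) s]

/-! ### (3) The stub -/

/-- **S4 · `stub_realisedStrictInequality` — Vishik–Fursikov realisation keeps the strict inequality.** Let
`ω ∈ 𝒦 = pathSpace R (pathLip ν A R)` be the coefficientwise limit (at every time `t ≥ 0`) of orbit paths of confined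
Galerkin orbits of levels `N_j → ∞` (exactly the output of the landed `stub_supportApprox`), and suppose `ω` has the
strict window-`[1,2]` inequality of S3. Then NS(ν, f) on T³ has a GLOBAL LERAY–HOPF SOLUTION `u` (tree's strict
sense, datum `u 0`) and times `0 < t₀ ≤ t₁` with the STRICT energy inequality
`½‖u(t₁)‖² + ν∫_{t₀}^{t₁}‖∇u‖² < ½‖u(t₀)‖² + ∫_{t₀}^{t₁}(f, u(t)) dt` in the tree's Leray–Hopf currency.
Proof: `exists_realisation_Ioo` gives `u` with `𝓕(u t)(k) = ω̄(s+t, k)`, `s ∈ (0,1)`; put `t₀ = 1-s`, `t₁ = 2-s`;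
Parseval three times (`integral_norm_sq_pathField`, `lintegral_eGradNormSq_pathField`,
`intervalIntegral_work_pathField`); the `ℝ≥0∞` strict inequality forces the dissipation finite, so `toReal` is exact.
[folklore; FoiasRosaTemam2013 Thm 3.1; VishikFursikov1988] -/
theorem stub_realisedStrictInequality :
    ∀ (ν : ℝ), 0 < ν → ∀ (f : UnitAddTorus (Fin 3) → EuclideanSpace ℝ (Fin 3)), Torus.IsSmooth f →
    ∀ (R A : ℝ) (N : ℕ → ℕ), Tendsto N atTop atTop →
    ∀ (c : (j : ℕ) → ↥(freqBall (N j) : Finset (Fin 3 → ℤ)) → EuclideanSpace ℂ (Fin 3)),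
      (∀ j, c j ∈ galerkinSubspace (freqBall (N j))) →
      (∀ j t, 0 ≤ t → ∑ k ∈ freqBall (N j), ‖coeffExt (freqBall (N j))
        (galerkinCoeffFlow ν (fourierRestrict (freqBall (N j)) f) t (c j)) k‖ ^ 2 ≤ R ^ 2) →
      (∀ j, orbitPath ν (fourierRestrict (freqBall (N j)) f) (c j) ∈ pathSpace R (pathLip ν A R)) →
    ∀ (ω : ℚ × (Fin 3 → ℤ) → EuclideanSpace ℂ (Fin 3)), ω ∈ pathSpace R (pathLip ν A R) →
      (∀ t, 0 ≤ t → ∀ k, Tendsto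
        (fun j => pathExt (orbitPath ν (fourierRestrict (freqBall (N j)) f) (c j)) t k) atTop
        (𝓝 (pathExt ω t k))) →
      ENNReal.ofReal (pathEnergyTot ω 2 / 2) +
          (⨆ K : ℕ, ENNReal.ofReal (∫ t in (1 : ℝ)..2, pathDiss ν K ω t)) <
        ENNReal.ofReal (pathEnergyTot ω 1 / 2 + ∫ t in (1 : ℝ)..2, ∑' k : Fin 3 → ℤ,
            (inner ℂ (mFourierCoeff (EuclideanSpace.complexify ∘ f) k) (pathExt ω t k)).re) →
    ∃ (u : ℝ → UnitAddTorus (Fin 3) → EuclideanSpace ℝ (Fin 3)) (t₀ t₁ : ℝ),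
      Torus.IsGlobalLerayHopf ν (fun _ => f) (u 0) u ∧ 0 < t₀ ∧ t₀ ≤ t₁ ∧
      Torus.kineticEnergy (u t₁) + ν * (∫⁻ τ in Ioo t₀ t₁, Torus.eGradNormSq (u τ)).toReal <
        Torus.kineticEnergy (u t₀) + ∫ τ in t₀..t₁, ∫ x, ⟪f x, u τ x⟫_ℝ := by
  intro ν hν f hf R A N hN c hc hconf hmem ω hω hlim hstrict
  -- (1) realisation after a strong time `s ∈ (0, 1)`
  obtain ⟨s, hs0, hs1, u, hLH, hu⟩ := exists_realisation_Ioo hν hf hN hc hconf hmem hω hlim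
  have hcoef : ∀ t, 0 ≤ t → ∀ k, mFourierCoeff (EuclideanSpace.complexify ∘ u t) k =
      pathExt ω (s + t) k := fun t ht => (hu t ht).2
  refine ⟨u, 1 - s, 2 - s, hLH, by linarith, by linarith, ?_⟩
  have ht₀ : 0 ≤ 1 - s := by linarith
  have ht₀₁ : 1 - s ≤ 2 - s := by linarith
  have hs1' : s + (1 - s) = 1 := by ring
  have hs2' : s + (2 - s) = 2 := by ring
  -- (2) Parseval: energies, dissipation, work
  have hE₁ : Torus.kineticEnergy (u (1 - s)) = pathEnergyTot ω 1 / 2 := by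
    rw [Torus.kineticEnergy, integral_norm_sq_pathField hu ht₀, hs1']
    ring
  have hE₂ : Torus.kineticEnergy (u (2 - s)) = pathEnergyTot ω 2 / 2 := by
    rw [Torus.kineticEnergy, integral_norm_sq_pathField hu (ht₀.trans ht₀₁), hs2']
    ring
  have hD : ∫⁻ τ in Ioo (1 - s) (2 - s), eGradNormSq (u τ) =
      ⨆ K : ℕ, ENNReal.ofReal (∫ t in (1 : ℝ)..2, pathDiss 1 K ω t) := by
    rw [lintegral_eGradNormSq_pathField hω hcoef ht₀ ht₀₁, hs1', hs2']
  have hW : ∫ τ in (1 - s)..(2 - s), ∫ x, ⟪f x, u τ x⟫_ℝ =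
      ∫ t in (1 : ℝ)..2, ∑' k : Fin 3 → ℤ,
        (inner ℂ (mFourierCoeff (EuclideanSpace.complexify ∘ f) k) (pathExt ω t k)).re := by
    rw [intervalIntegral_work_pathField (hf.memLp 2) hu ht₀ ht₀₁, hs1', hs2']
  -- the supremum of the resolved dissipations is `ofReal ν` times that of the resolved enstrophies
  set D : ℝ≥0∞ := ⨆ K : ℕ, ENNReal.ofReal (∫ t in (1 : ℝ)..2, pathDiss 1 K ω t) with hDdef
  have hS : (⨆ K : ℕ, ENNReal.ofReal (∫ t in (1 : ℝ)..2, pathDiss ν K ω t)) = ENNReal.ofReal ν * D := by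
    rw [hDdef, ENNReal.mul_iSup]
    refine iSup_congr fun K => ?_
    rw [← ENNReal.ofReal_mul hν.le, ← intervalIntegral.integral_const_mul]
    exact congrArg ENNReal.ofReal (intervalIntegral.integral_congr fun t _ =>
      pathDiss_eq_mul_pathDiss_one ν K ω t)
  rw [hS] at hstrict
  -- finiteness of the dissipation from the strict inequality
  have hfin : ENNReal.ofReal ν * D ≠ ⊤ := ne_top_of_lt (lt_of_le_of_lt le_add_self hstrict)
  have hDfin : D ≠ ⊤ := by
    intro hD'
    rw [hD', ENNReal.mul_top (by simpa using hν)] at hfin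
    exact hfin rfl
  -- (3) pass to real numbers
  have hE0 : 0 ≤ pathEnergyTot ω 2 / 2 := div_nonneg (pathEnergyTot_nonneg ω 2) zero_le_two
  have hlhs : ENNReal.ofReal (pathEnergyTot ω 2 / 2) + ENNReal.ofReal ν * D =
      ENNReal.ofReal (pathEnergyTot ω 2 / 2 + ν * D.toReal) := by
    rw [ENNReal.ofReal_add hE0 (mul_nonneg hν.le ENNReal.toReal_nonneg), ENNReal.ofReal_mul hν.le,
      ENNReal.ofReal_toReal hDfin]
  rw [hlhs] at hstrict
  have hreal := (ENNReal.ofReal_lt_ofReal_iff_of_nonneg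
    (add_nonneg hE0 (mul_nonneg hν.le ENNReal.toReal_nonneg))).1 hstrict
  rw [hE₁, hE₂, hD, hW]
  exact hreal

end Summit.AnomalousDissipation.AnomalousDissipation.Theorems.MomentParityResolvedDissipation.LhBracket.RealisedStrictInequality

end
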